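import Summits.CriticalPhenomena.PercolationContinuityZ3.Theorems.Transplant.SkelPhiParaCorridorKGY
import HarnessLib

/-!
# N2 (frames-only node `SamePDropOfSkeletonFrm₁`, OPEN), (C)/(R) corridor slots: **THE K-G CORRIDOR SLOT VALUES IN CLOSED FORM, SECOND AXIS**
# (N-corridor: y′-run ⧺ x-parking ⧺ y′-parking, `kgPark₁Y/kgPark₂Y/kgCorrSchedY`) — `Skelφ.kgM₁Y / kgE₁Y / kgWm₂Y / kgWp₂Y / kgM₂Y / kgXY / kgCtr2Y /
# kgHw2Y`, the discharges `KGYRows.kgYVals_ok₁` (`ParkOK (kgPark₁Y …)`), `kgYVals_ok₂` (`ParkOK (kgPark₂Y …)`), `kgYVals_split` (`hsplit`),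
# `kgYVals_park` (`hpark` of `kgCorrSchedY_core_last_subset`) from the N-FREE rows `Skelφ.KGYRows`, the arrival box at the values (`kgYVals_last`),
# the increment bound `kgXY_succ_le` (`ΔY := 3R′ + 2ρ + 2`) and the CENTRING run length `kgNY` (`kgNY_spec`; along unit = one coarse ROW).
Twin of SkelPhiCorridorKGValues (first axis) with the phases' roles exchanged: phase 2 parks ACROSS by x-strides (contraction `n − 2R′ − ρ` per stride,
stopped while the x-extent is still `≥ 2(n + |v|)` so that both y′-landing pieces fit), phase 3 parks ALONG by y′-hops (contraction `sL − 2R′ − ρ`,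
floor `P + ρ − 1` rows); the y′-run's along spread `(N+1)·dS` rides in phase 2's window.  Division of labour as in the first-axis file
(stmt-g20 instantiates and reads the creep/box slots through the frame→fine readings).
builds on p205010 (kernel theorem, internal audit signed; external expert review pending) — nothing in this file uses p205010; nothing here is a
claim about the open node `SamePDropOfSkeletonFrm₁`.
Lane `prim-bschramm`, seat `prim-bschramm-p5` (gen 16; (C) lineage); helper file (`--supports stmt-CriticalPhenomena-4575 --as helper`).
[cite: KozmaNitzan2024, §4 Lemma 12 (pp. 23–25: the target box of a corridor)] [cite: MartineauTassion2017, §4.3 Lemma 4.2 (steering)]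
-/

namespace Summit.CriticalPhenomena.PercolationContinuityZ3.Theorems.Transplant

namespace Skelφ

open Literature.Probability.Percolation Literature.Probability.LatticeModels SimpleGraph
open ChainPlanar ChainPara

/-! ## §1 Second axis: the closed terms -/

section KGYV

variable (n ℓ : ℕ) (hs v : ℤ) (R' ρ q W N : ℕ)

/-- Minimal progress of a y′-hop in rows: `sL := ⌊(nℓ − U + 1)/U⌋`. [this work] -/
def kgSLY : ℤ := ((n : ℤ) * ℓ - (shearUnit n hs : ℕ) + 1) / (shearUnit n hs : ℕ)

/-- Contraction per across-parking x-stride: `n − 2R′ − ρ`. [this work] -/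
def kgDec₁Y : ℤ := (n : ℤ) - 2 * R' - ρ

/-- What phase 2 must contract: `T₁ := (A⁻ + A⁺) − 2(n + |v|) = 2W + 2(N+1)R′ − 2|v|`. [this work] -/
def kgT₁Y : ℤ := 2 * W + 2 * (N + 1) * R' - 2 * |v|

/-- **Phase 2's step count** `m₁ := ⌊T₁/dec₁⌋ − 1`. [this work] -/
def kgM₁Y : ℕ := (kgT₁Y v R' W N / kgDec₁Y n R' ρ).toNat - 1

/-- **Phase 2's final across-extent** `E₁ := 2n + 2W + 2(N+1)R′ − (m₁+1)·dec₁` (`∈ [2(n+|v|), 2(n+|v|) + dec₁)`). [this work] -/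
def kgE₁Y : ℕ := (2 * (n : ℤ) + 2 * W + 2 * (N + 1) * R' - (((kgM₁Y n v R' ρ W N : ℕ) : ℤ) + 1) * kgDec₁Y n R' ρ).toNat

/-- Phase 3's lower start half-window `Wm₂ := ⌊E₁/2⌋`. [this work] -/
def kgWm₂Y : ℕ := kgE₁Y n v R' ρ W N / 2

/-- Phase 3's upper start half-window `Wp₂ := E₁ − ⌊E₁/2⌋`. [this work] -/
def kgWp₂Y : ℕ := kgE₁Y n v R' ρ W N - kgE₁Y n v R' ρ W N / 2

/-- Contraction per along-parking y′-hop: `sL − 2R′ − ρ`. [this work] -/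
def kgDec₂Y : ℤ := kgSLY n ℓ hs - 2 * R' - ρ

/-- Phase 3's start along-extent (rows): `T := 2(q + (N+1)R′) + (N+1)dS + 2(m₁+1)(R′+ρ)`. [this work] -/
def kgTY : ℤ := 2 * ((q : ℤ) + (N + 1) * R') + (N + 1) * (dS n ℓ hs : ℕ) + 2 * ((((kgM₁Y n v R' ρ W N : ℕ) : ℤ)) + 1) * (R' + ρ)

/-- **Phase 3's step count** `m₂ := max 1 ⌈(T − (P + ρ − 1))/dec₂⌉ − 1`, `P := ⌊nℓ/U⌋ + 1`. [this work] -/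
def kgM₂Y : ℕ :=
  (max 1 ((kgTY n ℓ hs v R' ρ q W N - ((n : ℤ) * ℓ / (shearUnit n hs : ℕ) + 1 + ρ - 1) + kgDec₂Y n ℓ hs R' ρ - 1) / kgDec₂Y n ℓ hs R' ρ)).toNat - 1

/-- **The arrival's along overshoot (rows)** `X := q + (N+1)R′ + (N+1)dS + (m₁+1)(R′+ρ) + (m₂+1)(R′+ρ)`: the arrival box is `(N+1)·sL + [X − (P+ρ−1), X]`.
[this work] -/
def kgXY : ℤ := (q : ℤ) + (N + 1) * R' + (N + 1) * (dS n ℓ hs : ℕ) + ((((kgM₁Y n v R' ρ W N : ℕ) : ℤ)) + 1) * (R' + ρ) +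
  ((((kgM₂Y n ℓ hs v R' ρ q W N : ℕ) : ℤ)) + 1) * (R' + ρ)

/-- **Twice the arrival's across centre** (x′ lattice units): `2(N+1)v + 2(A⁺ + (m₁+1)(R′+ρ)) − E₁`, `A⁺ = (n − v) + W + (N+1)R′`. [this work] -/
def kgCtr2Y : ℤ := 2 * ((N : ℤ) + 1) * v + 2 * (((kgA₁Yp n v R' W N : ℕ) : ℤ) + ((((kgM₁Y n v R' ρ W N : ℕ) : ℤ)) + 1) * (R' + ρ)) -
  ((kgE₁Y n v R' ρ W N : ℕ) : ℤ)

/-- **Twice the arrival's across half-width**: `E₁ + 2(m₂+1)(R′ + ρ + |v|)`. [this work] -/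
def kgHw2Y : ℤ := ((kgE₁Y n v R' ρ W N : ℕ) : ℤ) + 2 * (((((kgM₂Y n ℓ hs v R' ρ q W N : ℕ) : ℤ)) + 1) * (R' + ρ + |v|))

/-- **THE INPUT ROWS of the second-axis corridor algebra** (N-free): frame rows, contraction margins `6R′ + 3ρ + 2 ≤ sL` and `4R′ + 2ρ + 2 ≤ n`, zone rows,
start-window rows `P ≤ q` (the run's along window holds one hop's landing spread) and `3n ≤ 2W` (one across-parking stride is always due). [this work] -/
structure KGYRows (n ℓ : ℕ) (hs v : ℤ) (R' ρ q W : ℕ) : Prop where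
  /-- the pair has positive width -/
  hn : 1 ≤ n
  /-- the drift of a y′-hop is at most the width -/
  hv : |v| ≤ n
  /-- the layer inequality `n + |hs| ≤ nℓ + 1` -/
  hlay : (n + hs.natAbs : ℕ) ≤ (n : ℤ) * ℓ + 1
  /-- contraction margin of the along-parking: `sL − 2R′ − ρ ≥ 4R′ + 2ρ + 2` -/
  hR₁ : 6 * (R' : ℤ) + 3 * ρ + 2 ≤ kgSLY n ℓ hs
  /-- contraction margin of the across-parking: `n − 2R′ − ρ ≥ (n + 2)/2` -/
  hR₂ : 4 * R' + 2 * ρ + 2 ≤ n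
  /-- zone radius plus drift inside one width -/
  hρv : (ρ : ℤ) + |v| ≤ n
  /-- zone radius inside the along link box of an x-stride -/
  hρL : ρ ≤ 3 * (n * ℓ) / shearUnit n hs + 1
  /-- the run's along half-window holds one maximal hop: `P ≤ q` -/
  hq : n * ℓ / shearUnit n hs + 1 ≤ q
  /-- the run's extra across half-window: `3n ≤ 2W` -/
  hW : 3 * n ≤ 2 * W

variable {n ℓ hs v R' ρ q W}

/-- `dec₁ ≥ 2R′ + ρ + 2`, `2·dec₁ ≥ n + 2`. [folklore] -/
theorem KGYRows.dec₁_pos (H : KGYRows n ℓ hs v R' ρ q W) : 2 * (R' : ℤ) + ρ + 2 ≤ kgDec₁Y n R' ρ ∧ (n : ℤ) + 2 ≤ 2 * kgDec₁Y n R' ρ := by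
  have := H.hR₂; unfold kgDec₁Y; constructor <;> omega

/-- `dec₂ ≥ 4R′ + 2ρ + 2`. [folklore] -/
theorem KGYRows.dec₂_pos (H : KGYRows n ℓ hs v R' ρ q W) : 4 * (R' : ℤ) + 2 * ρ + 2 ≤ kgDec₂Y n ℓ hs R' ρ := by
  have := H.hR₁; unfold kgDec₂Y; linarith

/-- `(n ± v)⁺ = n ± v` under `|v| ≤ n`. [folklore] -/
theorem KGYRows.toNat_eq (H : KGYRows n ℓ hs v R' ρ q W) : (((n : ℤ) + v).toNat : ℤ) = n + v ∧ (((n : ℤ) - v).toNat : ℤ) = n - v := by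
  have := abs_le.1 H.hv
  exact ⟨Int.toNat_of_nonneg (by omega), Int.toNat_of_nonneg (by omega)⟩

/-- `dS ≤ 2`. [folklore] -/
theorem dS_le_two (n ℓ : ℕ) (hs : ℤ) : dS n ℓ hs ≤ 2 := by
  unfold dS
  have : n * ℓ / shearUnit n hs ≤ (n * ℓ + 1) / shearUnit n hs := Nat.div_le_div_right (by omega)
  omega

/-- **`m₁ + 1 = ⌊T₁/dec₁⌋ ≥ 1`.** [this work] -/
theorem KGYRows.kgM₁Y_spec (H : KGYRows n ℓ hs v R' ρ q W) (N : ℕ) :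
    (((kgM₁Y n v R' ρ W N : ℕ) : ℤ)) + 1 = kgT₁Y v R' W N / kgDec₁Y n R' ρ ∧ 1 ≤ kgT₁Y v R' W N / kgDec₁Y n R' ρ := by
  have hd := H.dec₁_pos.1
  have hρ0 : (0 : ℤ) ≤ ρ := by positivity
  have hd0 : 0 < kgDec₁Y n R' ρ := by linarith
  have hT : kgDec₁Y n R' ρ ≤ kgT₁Y v R' W N := by
    have h1 := H.hW; have h2 := H.hv; have : (0 : ℤ) ≤ (N + 1) * R' := by positivity
    have h1' : 3 * (n : ℤ) ≤ 2 * W := by exact_mod_cast h1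
    unfold kgT₁Y kgDec₁Y; linarith
  have h1 : 1 ≤ kgT₁Y v R' W N / kgDec₁Y n R' ρ := by rw [Int.le_ediv_iff_mul_le hd0]; linarith
  refine ⟨?_, h1⟩
  unfold kgM₁Y
  have h2 : ((kgT₁Y v R' W N / kgDec₁Y n R' ρ).toNat : ℤ) = kgT₁Y v R' W N / kgDec₁Y n R' ρ := Int.toNat_of_nonneg (by linarith)
  have h3 : 1 ≤ (kgT₁Y v R' W N / kgDec₁Y n R' ρ).toNat := by
    have : (1 : ℤ) ≤ ((kgT₁Y v R' W N / kgDec₁Y n R' ρ).toNat : ℤ) := by rw [h2]; exact h1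
    exact_mod_cast this
  rw [Nat.cast_sub h3]; push_cast; linarith

/-- **`E₁ = 2n + 2W + 2(N+1)R′ − (m₁+1)·dec₁` and `2(n+|v|) ≤ E₁ < 2(n+|v|) + dec₁`.** [this work] -/
theorem KGYRows.kgE₁Y_spec (H : KGYRows n ℓ hs v R' ρ q W) (N : ℕ) :
    ((kgE₁Y n v R' ρ W N : ℕ) : ℤ) = 2 * (n : ℤ) + 2 * W + 2 * (N + 1) * R' - (((kgM₁Y n v R' ρ W N : ℕ) : ℤ) + 1) * kgDec₁Y n R' ρ ∧
    2 * ((n : ℤ) + |v|) ≤ ((kgE₁Y n v R' ρ W N : ℕ) : ℤ) ∧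
    ((kgE₁Y n v R' ρ W N : ℕ) : ℤ) < 2 * ((n : ℤ) + |v|) + kgDec₁Y n R' ρ := by
  have hd := H.dec₁_pos.1
  have hρ0 : (0 : ℤ) ≤ ρ := by positivity
  have hd0 : 0 < kgDec₁Y n R' ρ := by linarith
  obtain ⟨hm, h1⟩ := H.kgM₁Y_spec N
  have hfl : kgDec₁Y n R' ρ * (kgT₁Y v R' W N / kgDec₁Y n R' ρ) ≤ kgT₁Y v R' W N ∧
      kgT₁Y v R' W N < kgDec₁Y n R' ρ * (kgT₁Y v R' W N / kgDec₁Y n R' ρ) + kgDec₁Y n R' ρ := by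
    have h := And.intro (Int.mul_ediv_add_emod (kgT₁Y v R' W N) (kgDec₁Y n R' ρ))
      (And.intro (Int.emod_nonneg (kgT₁Y v R' W N) hd0.ne') (Int.emod_lt_of_pos (kgT₁Y v R' W N) hd0))
    constructor <;> linarith [h.1, h.2.1, h.2.2]
  rw [← hm] at hfl
  have hA : 2 * (n : ℤ) + 2 * W + 2 * (N + 1) * R' = 2 * ((n : ℤ) + |v|) + kgT₁Y v R' W N := by unfold kgT₁Y; ring
  have hvn : (0 : ℤ) ≤ |v| := abs_nonneg v
  have hnn : 0 ≤ 2 * (n : ℤ) + 2 * W + 2 * (N + 1) * R' - (((kgM₁Y n v R' ρ W N : ℕ) : ℤ) + 1) * kgDec₁Y n R' ρ := by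
    rw [hA]; nlinarith [hfl.1]
  have hE : ((kgE₁Y n v R' ρ W N : ℕ) : ℤ) = 2 * (n : ℤ) + 2 * W + 2 * (N + 1) * R' - (((kgM₁Y n v R' ρ W N : ℕ) : ℤ) + 1) * kgDec₁Y n R' ρ := by
    unfold kgE₁Y; exact Int.toNat_of_nonneg hnn
  refine ⟨hE, ?_, ?_⟩
  · rw [hE, hA]; nlinarith [hfl.1]
  · rw [hE, hA]; nlinarith [hfl.2]

/-- `Wm₂ + Wp₂ = E₁`. [folklore] -/
theorem kgWm₂Y_add_kgWp₂Y (N : ℕ) : kgWm₂Y n v R' ρ W N + kgWp₂Y n v R' ρ W N = kgE₁Y n v R' ρ W N := by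
  unfold kgWm₂Y kgWp₂Y; omega

/-- **SLOT LEDGER DISCHARGE, phase 2 (y-direction)**. [this work] -/
theorem KGYRows.kgYVals_ok₁ (H : KGYRows n ℓ hs v R' ρ q W) (N : ℕ) : ParkOK (kgPark₁Y n ℓ hs v R' ρ q W N (kgM₁Y n v R' ρ W N)) := by
  refine kgPark₁Y_ok _ H.hn ?_ H.hρL ?_
  · have := H.hR₂; omega
  · have := H.hq; nlinarith [Nat.zero_le ((N + 1) * R'), Nat.zero_le ((N + 1) * dS n ℓ hs)]

/-- **SLOT LEDGER DISCHARGE, phase 3 (y-direction)**. [this work] -/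
theorem KGYRows.kgYVals_ok₂ (H : KGYRows n ℓ hs v R' ρ q W) (N : ℕ) :
    ParkOK (kgPark₂Y n ℓ hs v R' ρ q W N (kgM₁Y n v R' ρ W N) (kgWm₂Y n v R' ρ W N) (kgWp₂Y n v R' ρ W N) (kgM₂Y n ℓ hs v R' ρ q W N)) := by
  refine kgPark₂Y_ok _ _ H.hn H.hv H.hlay ?_ H.hρv ?_
  · have := H.hR₁; unfold kgSLY at this; linarith
  · have hsum : ((kgWm₂Y n v R' ρ W N : ℕ) : ℤ) + (kgWp₂Y n v R' ρ W N : ℕ) = (kgE₁Y n v R' ρ W N : ℕ) := by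
      exact_mod_cast kgWm₂Y_add_kgWp₂Y (n := n) (v := v) (R' := R') (ρ := ρ) (W := W) N
    rw [hsum]; exact (H.kgE₁Y_spec N).2.1

/-- **THE WINDOW SPLIT `hsplit` (y-direction)**: phase 2's final across-extent is `E₁` exactly. [this work] -/
theorem KGYRows.kgYVals_split (H : KGYRows n ℓ hs v R' ρ q W) (N : ℕ) :
    ((kgWm₂Y n v R' ρ W N : ℕ) : ℤ) + (kgWp₂Y n v R' ρ W N : ℕ) =
      (kgPark₁Y n ℓ hs v R' ρ q W N (kgM₁Y n v R' ρ W N)).aHi (kgM₁Y n v R' ρ W N + 1) -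
        ParkPrm.aLo (kgPark₁Y n ℓ hs v R' ρ q W N (kgM₁Y n v R' ρ W N)) (kgM₁Y n v R' ρ W N + 1) := by
  have hP := H.kgYVals_ok₁ N
  obtain ⟨hE, hE2, _⟩ := H.kgE₁Y_spec N
  obtain ⟨hvn, hvp⟩ := H.toNat_eq
  have hR₂ := H.hR₂
  have hvv : (0 : ℤ) ≤ |v| := abs_nonneg v
  set P₁ := kgPark₁Y n ℓ hs v R' ρ q W N (kgM₁Y n v R' ρ W N) with hP₁def
  have hA : P₁.A - P₁.aLo0 = 2 * (n : ℤ) + 2 * W + 2 * (N + 1) * R' := by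
    simp only [hP₁def, kgPark₁Y, xParkPrmW, kgA₁Ym, kgA₁Yp]; push_cast; rw [hvn, hvp]; ring
  have hsHi : P₁.sHi = n := by simp only [hP₁def, kgPark₁Y, xParkPrmW]
  have hρ' : (P₁.ρ : ℤ) = ρ := by simp only [hP₁def, kgPark₁Y, xParkPrmW]
  have hsLo : P₁.sLo = n := by simp only [hP₁def, kgPark₁Y, xParkPrmW]
  have hea : (P₁.ea : ℤ) = R' := by simp only [hP₁def, kgPark₁Y, xParkPrmW]
  have h0 : P₁.sHi + P₁.ρ - 1 ≤ P₁.A - P₁.aLo0 := by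
    rw [hA, hsHi, hρ']; nlinarith [Nat.zero_le ((N + 1) * R'), Nat.zero_le W]
  have e := ParkPrm.extent_eq hP h0 (kgM₁Y n v R' ρ W N + 1)
  have hsum : ((kgWm₂Y n v R' ρ W N : ℕ) : ℤ) + (kgWp₂Y n v R' ρ W N : ℕ) = (kgE₁Y n v R' ρ W N : ℕ) := by
    exact_mod_cast kgWm₂Y_add_kgWp₂Y (n := n) (v := v) (R' := R') (ρ := ρ) (W := W) N
  have hE' : ((kgE₁Y n v R' ρ W N : ℕ) : ℤ) = P₁.A - P₁.aLo0 - (((kgM₁Y n v R' ρ W N + 1 : ℕ) : ℤ)) * (P₁.sLo - 2 * P₁.ea - P₁.ρ) := by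
    rw [hE, hA, hsLo, hea, hρ']; unfold kgDec₁Y; push_cast; ring
  have hfloor : P₁.sHi + P₁.ρ - 1 ≤ P₁.A - P₁.aLo0 - (((kgM₁Y n v R' ρ W N + 1 : ℕ) : ℤ)) * (P₁.sLo - 2 * P₁.ea - P₁.ρ) := by
    rw [← hE', hsHi, hρ']; linarith
  rw [e, max_eq_left hfloor, hsum, hE']

/-- **`m₂ + 1 = max 1 ⌈(T − (P+ρ−1))/dec₂⌉`** and the contraction it buys. [this work] -/
theorem KGYRows.kgM₂Y_spec (H : KGYRows n ℓ hs v R' ρ q W) (N : ℕ) :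
    (((kgM₂Y n ℓ hs v R' ρ q W N : ℕ) : ℤ)) + 1 =
      max 1 ((kgTY n ℓ hs v R' ρ q W N - ((n : ℤ) * ℓ / (shearUnit n hs : ℕ) + 1 + ρ - 1) + kgDec₂Y n ℓ hs R' ρ - 1) / kgDec₂Y n ℓ hs R' ρ) ∧
    kgTY n ℓ hs v R' ρ q W N - ((n : ℤ) * ℓ / (shearUnit n hs : ℕ) + 1 + ρ - 1) ≤ ((((kgM₂Y n ℓ hs v R' ρ q W N : ℕ) : ℤ)) + 1) * kgDec₂Y n ℓ hs R' ρ := by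
  have hd := H.dec₂_pos
  have hρ0 : (0 : ℤ) ≤ ρ := by positivity
  have hd0 : 0 < kgDec₂Y n ℓ hs R' ρ := by linarith
  set T := kgTY n ℓ hs v R' ρ q W N - ((n : ℤ) * ℓ / (shearUnit n hs : ℕ) + 1 + ρ - 1) with hT
  set c := (T + kgDec₂Y n ℓ hs R' ρ - 1) / kgDec₂Y n ℓ hs R' ρ with hc
  have hmx : (1 : ℤ) ≤ max 1 c := le_max_left _ _
  have h1 : (((kgM₂Y n ℓ hs v R' ρ q W N : ℕ) : ℤ)) + 1 = max 1 c := by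
    unfold kgM₂Y
    have h2 : ((max 1 c).toNat : ℤ) = max 1 c := Int.toNat_of_nonneg (by linarith)
    have h3 : 1 ≤ (max 1 c).toNat := by
      have : (1 : ℤ) ≤ ((max 1 c).toNat : ℤ) := by rw [h2]; exact hmx
      exact_mod_cast this
    rw [← hT, ← hc, Nat.cast_sub h3]; push_cast; linarith
  refine ⟨h1, ?_⟩
  rw [h1]
  have hce : T ≤ kgDec₂Y n ℓ hs R' ρ * c := by
    have h := And.intro (Int.mul_ediv_add_emod (T + kgDec₂Y n ℓ hs R' ρ - 1) (kgDec₂Y n ℓ hs R' ρ))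
      (And.intro (Int.emod_nonneg (T + kgDec₂Y n ℓ hs R' ρ - 1) hd0.ne') (Int.emod_lt_of_pos (T + kgDec₂Y n ℓ hs R' ρ - 1) hd0))
    rw [hc]; linarith [h.1, h.2.1, h.2.2]
  have : c ≤ max 1 c := le_max_right _ _
  nlinarith

/-- **THE PARKING ROW `hpark` (y-direction)** of `kgCorrSchedY_core_last_subset` at the values. [this work] -/
theorem KGYRows.kgYVals_park (H : KGYRows n ℓ hs v R' ρ q W) (N : ℕ) :
    2 * ((q : ℤ) + (N + 1) * R') + (N + 1) * (dS n ℓ hs : ℕ) + 2 * ((((kgM₁Y n v R' ρ W N : ℕ) : ℤ)) + 1) * (R' + ρ) ≤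
      ((n : ℤ) * ℓ / (shearUnit n hs : ℕ) + 1) + ρ - 1 +
        ((((kgM₂Y n ℓ hs v R' ρ q W N : ℕ) : ℤ)) + 1) * ((((n : ℤ) * ℓ - (shearUnit n hs : ℕ) + 1) / (shearUnit n hs : ℕ)) - 2 * R' - ρ) := by
  have h := (H.kgM₂Y_spec N).2
  unfold kgTY kgDec₂Y kgSLY at h
  linarith

/-- **THE ARRIVAL BOX AT THE VALUES (y-direction)**: along (rows) `y₁ − (N+1)·sL ∈ [X − (P+ρ−1), X]`, across `2·y₀ ∈ [Ctr2 − Hw2, Ctr2 + Hw2]`.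
[cite: KozmaNitzan2024, §4 Lemma 12 (pp. 23–25: the target box)] -/
theorem KGYRows.kgYVals_last (H : KGYRows n ℓ hs v R' ρ q W) (N : ℕ) {y : Site 2}
    (hy : y ∈ (kgCorrSchedY H.hn H.hv H.hlay (H.kgYVals_ok₁ N) (H.kgYVals_ok₂ N) (H.kgYVals_split N)).core
      ((kgCorrSchedY H.hn H.hv H.hlay (H.kgYVals_ok₁ N) (H.kgYVals_ok₂ N) (H.kgYVals_split N)).N + 1)) :
    (kgXY n ℓ hs v R' ρ q W N - ((n : ℤ) * ℓ / (shearUnit n hs : ℕ) + 1 + ρ - 1) ≤ y 1 - ((N : ℤ) + 1) * kgSLY n ℓ hs ∧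
      y 1 - ((N : ℤ) + 1) * kgSLY n ℓ hs ≤ kgXY n ℓ hs v R' ρ q W N) ∧
    (kgCtr2Y n v R' ρ W N - kgHw2Y n ℓ hs v R' ρ q W N ≤ 2 * y 0 ∧ 2 * y 0 ≤ kgCtr2Y n v R' ρ W N + kgHw2Y n ℓ hs v R' ρ q W N) := by
  obtain ⟨⟨h1, h2⟩, h3, h4⟩ := kgCorrSchedY_core_last_subset H.hn H.hv H.hlay (H.kgYVals_ok₁ N) (H.kgYVals_ok₂ N) (H.kgYVals_split N)
    (H.kgYVals_park N) hy
  have hsum : ((kgWm₂Y n v R' ρ W N : ℕ) : ℤ) + (kgWp₂Y n v R' ρ W N : ℕ) = (kgE₁Y n v R' ρ W N : ℕ) := by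
    exact_mod_cast kgWm₂Y_add_kgWp₂Y (n := n) (v := v) (R' := R') (ρ := ρ) (W := W) N
  unfold kgXY kgSLY
  unfold kgCtr2Y kgHw2Y
  refine ⟨⟨by linarith, by linarith⟩, by linarith, by linarith⟩

/-- **The increment bound of the along overshoot in the run length (y-direction)**: `ΔY := 3R′ + 2ρ + 2`. [this work] -/
def kgΔY (R' ρ : ℕ) : ℤ := 3 * R' + 2 * ρ + 2

/-- `m₁(N+1) + 1 ≤ (m₁(N) + 1) + 1`. [this work] -/
theorem KGYRows.kgM₁Y_succ_le (H : KGYRows n ℓ hs v R' ρ q W) (N : ℕ) :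
    (((kgM₁Y n v R' ρ W (N + 1) : ℕ) : ℤ)) ≤ (kgM₁Y n v R' ρ W N : ℕ) + 1 := by
  have hd := H.dec₁_pos.1
  have hρ0 : (0 : ℤ) ≤ ρ := by positivity
  have hd0 : 0 < kgDec₁Y n R' ρ := by linarith
  have e0 := (H.kgM₁Y_spec N).1
  have e1 := (H.kgM₁Y_spec (N + 1)).1
  have hT : kgT₁Y v R' W (N + 1) = kgT₁Y v R' W N + 2 * R' := by unfold kgT₁Y; push_cast; ring
  -- `⌊(T + a)/d⌋ ≤ ⌊T/d⌋ + 1` for `0 ≤ a < d`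
  have h1 := And.intro (Int.mul_ediv_add_emod (kgT₁Y v R' W N) (kgDec₁Y n R' ρ)) (Int.emod_lt_of_pos (kgT₁Y v R' W N) hd0)
  have h2 := And.intro (Int.mul_ediv_add_emod (kgT₁Y v R' W N + 2 * R') (kgDec₁Y n R' ρ))
    (Int.emod_nonneg (kgT₁Y v R' W N + 2 * R') hd0.ne')
  have h3 : kgDec₁Y n R' ρ * ((kgT₁Y v R' W N + 2 * R') / kgDec₁Y n R' ρ) < kgDec₁Y n R' ρ * (kgT₁Y v R' W N / kgDec₁Y n R' ρ + 2) := by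
    linarith [h1.1, h1.2, h2.1, h2.2]
  have h4 := lt_of_mul_lt_mul_left h3 hd0.le
  rw [← hT, ← e1, ← e0] at h4
  linarith

/-- `m₂(N+1) + 1 ≤ (m₂(N) + 1) + 1`. [this work] -/
theorem KGYRows.kgM₂Y_succ_le (H : KGYRows n ℓ hs v R' ρ q W) (N : ℕ) :
    (((kgM₂Y n ℓ hs v R' ρ q W (N + 1) : ℕ) : ℤ)) ≤ (kgM₂Y n ℓ hs v R' ρ q W N : ℕ) + 1 := by
  have hd := H.dec₂_pos
  have hρ0 : (0 : ℤ) ≤ ρ := by positivity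
  have hR0 : (0 : ℤ) ≤ R' := by positivity
  have hd0 : 0 < kgDec₂Y n ℓ hs R' ρ := by linarith
  have e0 := (H.kgM₂Y_spec N).1
  have e1 := (H.kgM₂Y_spec (N + 1)).1
  have hm₁ := H.kgM₁Y_succ_le N
  have hdS : ((dS n ℓ hs : ℕ) : ℤ) ≤ 2 := by exact_mod_cast dS_le_two n ℓ hs
  set F : ℤ := (n : ℤ) * ℓ / (shearUnit n hs : ℕ) + 1 + ρ - 1 with hF
  set d := kgDec₂Y n ℓ hs R' ρ with hdd
  set a : ℤ := kgTY n ℓ hs v R' ρ q W (N + 1) - kgTY n ℓ hs v R' ρ q W N with ha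
  have ha1 : a ≤ 1 * d := by
    have : a = 2 * R' + (dS n ℓ hs : ℕ) + 2 * ((((kgM₁Y n v R' ρ W (N + 1) : ℕ) : ℤ)) - (kgM₁Y n v R' ρ W N : ℕ)) * (R' + ρ) := by
      simp only [ha]; unfold kgTY; push_cast; ring
    rw [this]
    have h1 : ((((kgM₁Y n v R' ρ W (N + 1) : ℕ) : ℤ)) - (kgM₁Y n v R' ρ W N : ℕ)) * (R' + ρ) ≤ 1 * (R' + ρ) :=
      mul_le_mul_of_nonneg_right (by linarith) (by linarith)
    linarith
  -- `⌈(T + a)/d⌉ ≤ ⌈T/d⌉ + 1` for `a ≤ d`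
  have h : (kgTY n ℓ hs v R' ρ q W (N + 1) - F + d - 1) / d ≤ (kgTY n ℓ hs v R' ρ q W N - F + d - 1) / d + 1 := by
    have h1 : (kgTY n ℓ hs v R' ρ q W (N + 1) - F + d - 1) / d ≤ (kgTY n ℓ hs v R' ρ q W N - F + d - 1 + 1 * d) / d :=
      Int.ediv_le_ediv hd0 (by linarith)
    rw [Int.add_mul_ediv_right _ _ hd0.ne'] at h1
    exact h1
  have hmax : max 1 ((kgTY n ℓ hs v R' ρ q W (N + 1) - F + d - 1) / d) ≤ max 1 ((kgTY n ℓ hs v R' ρ q W N - F + d - 1) / d) + 1 := by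
    refine max_le (by linarith [le_max_left (1 : ℤ) ((kgTY n ℓ hs v R' ρ q W N - F + d - 1) / d)]) ?_
    linarith [le_max_right (1 : ℤ) ((kgTY n ℓ hs v R' ρ q W N - F + d - 1) / d)]
  rw [← e0, ← e1] at hmax
  linarith

/-- **ONE MORE RUN HOP MOVES THE ARRIVAL'S FAR EDGE BY AT MOST `sL + ΔY` ROWS**: `XY(N+1) ≤ XY(N) + ΔY`. [this work] -/
theorem KGYRows.kgXY_succ_le (H : KGYRows n ℓ hs v R' ρ q W) (N : ℕ) :
    kgXY n ℓ hs v R' ρ q W (N + 1) ≤ kgXY n ℓ hs v R' ρ q W N + kgΔY R' ρ := by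
  obtain ⟨hm₁, hm₂⟩ := And.intro (H.kgM₁Y_succ_le N) (H.kgM₂Y_succ_le N)
  have hρ0 : (0 : ℤ) ≤ ρ := by positivity
  have hdS : ((dS n ℓ hs : ℕ) : ℤ) ≤ 2 := by exact_mod_cast dS_le_two n ℓ hs
  unfold kgXY kgΔY
  push_cast
  have h1 : ((((kgM₁Y n v R' ρ W (N + 1) : ℕ) : ℤ)) + 1) * (R' + ρ) ≤ ((((kgM₁Y n v R' ρ W N : ℕ) : ℤ)) + 1 + 1) * (R' + ρ) :=
    mul_le_mul_of_nonneg_right (by linarith) (by linarith)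
  have h2 : ((((kgM₂Y n ℓ hs v R' ρ q W (N + 1) : ℕ) : ℤ)) + 1) * (R' + ρ) ≤ ((((kgM₂Y n ℓ hs v R' ρ q W N : ℕ) : ℤ)) + 1 + 1) * (R' + ρ) :=
    mul_le_mul_of_nonneg_right (by linarith) (by linarith)
  nlinarith

/-- `0 ≤ XY(N)`. [folklore] -/
theorem kgXY_nonneg (N : ℕ) : 0 ≤ kgXY n ℓ hs v R' ρ q W N := by
  unfold kgXY; positivity

/-! ## §2 Second axis: the centring choice of the run length (along unit = one coarse row) -/

/-- **The arrival's far edge (rows)** after `N + 1` hops: `fY(N) := (N+1)·sL + XY(N)`. [this work] -/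
def kgFarY (n ℓ : ℕ) (hs v : ℤ) (R' ρ q W N : ℕ) : ℤ := ((N : ℤ) + 1) * kgSLY n ℓ hs + kgXY n ℓ hs v R' ρ q W N

/-- **THE RUN LENGTH (y-direction)**: the largest `N ≤ ⌊tgt/sL⌋` whose arrival far edge is `≤ tgt` rows. [this work] -/
def kgNY (n ℓ : ℕ) (hs v : ℤ) (R' ρ q W : ℕ) (tgt : ℤ) : ℕ :=
  Nat.findGreatest (fun N => kgFarY n ℓ hs v R' ρ q W N ≤ tgt) (tgt.toNat / (kgSLY n ℓ hs).toNat)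

/-- **CENTRING (y-direction)**: at `N := kgNY … tgt` the arrival far edge lies in `(tgt − sL − ΔY, tgt]`, provided one hop already fits. [this work] -/
theorem KGYRows.kgNY_spec (H : KGYRows n ℓ hs v R' ρ q W) {tgt : ℤ} (h0 : kgFarY n ℓ hs v R' ρ q W 0 ≤ tgt) :
    kgFarY n ℓ hs v R' ρ q W (kgNY n ℓ hs v R' ρ q W tgt) ≤ tgt ∧
      tgt < kgFarY n ℓ hs v R' ρ q W (kgNY n ℓ hs v R' ρ q W tgt) + kgSLY n ℓ hs + kgΔY R' ρ := by
  have hρ0 : (0 : ℤ) ≤ ρ := by positivity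
  have hR0 : (0 : ℤ) ≤ R' := by positivity
  have hsl : 0 < kgSLY n ℓ hs := by have := H.hR₁; linarith
  set s : ℕ := (kgSLY n ℓ hs).toNat with hs'
  have hss : (s : ℤ) = kgSLY n ℓ hs := Int.toNat_of_nonneg hsl.le
  have hs0 : 0 < s := by
    have : (0 : ℤ) < (s : ℤ) := by rw [hss]; exact hsl
    exact_mod_cast this
  have hspec : kgFarY n ℓ hs v R' ρ q W (kgNY n ℓ hs v R' ρ q W tgt) ≤ tgt := by
    unfold kgNY
    exact Nat.findGreatest_spec (P := fun N => kgFarY n ℓ hs v R' ρ q W N ≤ tgt) (Nat.zero_le _) h0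
  refine ⟨hspec, ?_⟩
  have hfail : tgt < kgFarY n ℓ hs v R' ρ q W (kgNY n ℓ hs v R' ρ q W tgt + 1) := by
    by_contra hcon
    have hle1 : kgFarY n ℓ hs v R' ρ q W (kgNY n ℓ hs v R' ρ q W tgt + 1) ≤ tgt := not_lt.1 hcon
    by_cases hlt : kgNY n ℓ hs v R' ρ q W tgt < tgt.toNat / s
    · exact Nat.findGreatest_is_greatest (P := fun N => kgFarY n ℓ hs v R' ρ q W N ≤ tgt) (Nat.lt_succ_self _) hlt hle1
    · have hle : tgt.toNat / s ≤ kgNY n ℓ hs v R' ρ q W tgt := not_lt.1 hlt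
      have hX := kgXY_nonneg (n := n) (ℓ := ℓ) (hs := hs) (v := v) (R' := R') (ρ := ρ) (q := q) (W := W) (kgNY n ℓ hs v R' ρ q W tgt + 1)
      unfold kgFarY at hle1
      push_cast at hle1
      have hg0 : (0 : ℤ) ≤ ((kgNY n ℓ hs v R' ρ q W tgt : ℕ) : ℤ) := by positivity
      have htgt0 : 0 ≤ tgt := by nlinarith
      have h1 : (tgt.toNat : ℤ) = tgt := Int.toNat_of_nonneg htgt0
      have h2 : tgt.toNat < (tgt.toNat / s + 1) * s := Nat.lt_mul_of_div_lt (Nat.lt_succ_self _) hs0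
      have h3 : ((tgt.toNat : ℕ) : ℤ) < (((tgt.toNat / s + 1) * s : ℕ) : ℤ) := by exact_mod_cast h2
      rw [h1] at h3
      push_cast at h3
      rw [hss] at h3
      have hle' : (((tgt.toNat / s : ℕ) : ℤ)) ≤ (kgNY n ℓ hs v R' ρ q W tgt : ℕ) := by exact_mod_cast hle
      have h4 : ((((tgt.toNat / s : ℕ) : ℤ)) + 1) * kgSLY n ℓ hs ≤ (((kgNY n ℓ hs v R' ρ q W tgt : ℕ) : ℤ) + 2) * kgSLY n ℓ hs :=
        mul_le_mul_of_nonneg_right (by linarith) hsl.le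
      nlinarith
  have hinc := H.kgXY_succ_le (kgNY n ℓ hs v R' ρ q W tgt)
  unfold kgFarY at hfail ⊢
  push_cast at hfail ⊢
  nlinarith

end KGYV

end Skelφ

end Summit.CriticalPhenomena.PercolationContinuityZ3.Theorems.Transplant
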